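import Mathlib
import HarnessLib
import Summits.NavierStokesRegularity.NavierStokesRegularity.Theorems.PoloidalWindowDoorPoloidalWindowRigidityK2OfLrc
import Summits.NavierStokesRegularity.NavierStokesRegularity.Theorems.PoloidalWindowDoorPoloidalWindowRigidityConstantShear
import Summits.NavierStokesRegularity.NavierStokesRegularity.Theorems.PoloidalWindowDoorPoloidalWindowRigidityProportionalShear
import Summits.NavierStokesRegularity.NavierStokesRegularity.Theorems.PoloidalWindowDoorPoloidalWindowRigidityOneSliceCurlAxisymmetric

/-!
# Route `PoloidalWindowDoor`, crux `PoloidalWindowRigidity` (K2, stmt-NavierStokesRegularity-19708) — line «lrc-jet», DIRECTOR-NS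
# g7 #21: the CONSTANT-SLOPE DICHOTOMY (`stub_constSlope`) and the composition `K2 ⇐ LRC″` (the restated `stub_k2OfLrc`)

Cell ns-regularity-ideate, seat ns-poloidal-K2-p3 gen 4 (stub-worker under the K2 lead ns-poloidal-K2-p1; file landed
`--supports stmt-NavierStokesRegularity-19708` as a helper; the lead registers the line and names the stubs).

Refuter1's flow K-a (STATUS 2026-08-27T07:57Z: three crossed oblique suction layers, steady, poloidal, Clebsch slope `Λ ≡ ½`,
proportional shear `∂₂v_h = −∇_h v₂`, vorticity with NO one-parameter isometry) kills LRC′ as stated; it lives on the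
CONSTANT-SLOPE stratum, which is empty in the Type-I class (ns-poloidal-K2-p2 `…ConstantShear`, p511024, every constant `μ < 1`;
ns-poloidal-K2-p1 `…ProportionalShear`, p463086, every constant `μ > 0`).  DIRECTOR-NS #21 therefore restates the line as
LRC″ («… AND the slope is not locally constant ⇒ symmetric vorticity») plus the routine dichotomy «slope constant on some open
space–time set ⇒ constant shear everywhere ⇒ p511024/p463086».  This file is that dichotomy and the re-wired composition:

* `shear_of_local_shear` — if `∂₂v_b = μ ∂_b v₂` (`b = 0,1`) holds on a nonempty open SPACE–TIME subset of the backward slab,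
  it holds on the whole slab (joint real-analyticity of `(s,y) ↦ Dv(s)(y)`, tree `analyticOnNhd_uncurry_fderiv_slice_apply`).
* `nonflatLiouville_of_constantShear_real` — **the μ-range answer asked of K2-p2/p7 in #21 (2), in the kernel: EVERY real `μ`
  is covered** (`μ < 1`: p511024; `1 ≤ μ`: p463086).  Dictionary `μ = 1 − 1/Λ`: `Λ ∈ (0,1) ↔ μ < 0`, `Λ > 1 ↔ μ ∈ (0,1)`,
  `Λ < 0 ↔ μ > 1`, `Λ = 1 ↔ μ = 0`; the two halves overlap on `μ ∈ (0,1)` and nothing is left over or excluded by the class.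
* `nonflatLiouville_of_local_constantShear` — **`stub_constSlope`**: class + poloidal + constant shear on SOME nonempty open
  space–time set ⇒ not backward-singular.
* `shear_of_clebschSlope_of_nondegenerate` — pointwise dictionary: at a point with `∇_h v₂ ≠ 0`, the Clebsch-slope identities
  `∂₀v₂ = −Λ ω₁`, `∂₁v₂ = Λ ω₀` force `Λ ≠ 0` and the shear identities with `μ = 1 − 1/Λ`.
* `nonflatLiouville_of_lrc_slope` — **`K2 ⇐ LRC″` (class form).**  Hypothesis `hLRC`: for every nonempty open `W` in the slab
  on which pointwise `ω ≠ 0`, `∇_h v₂ ≠ 0`, `∂₂v_h ≠ 0` (non-degenerate: `Λ ∉ {0,1}`) AND on which the shear slope is NOWHERE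
  LOCALLY CONSTANT (no real `μ` and no nonempty open `W₁ ⊆ W` with `∂₂v_b ≡ μ∂_b v₂` on `W₁`), there is a slice `s < 0` and a
  nonempty open `U ⊆ ℝ³` carrying a translation germ of the vorticity (`D(curl v(s))[e] = 0`, `e ≠ 0`) or a rotation germ about
  SOME vertical axis (`J curl v(s)(y) = D(curl v(s))(y)[J(y − c)]`).  Conclusion: `¬ IsBackwardSingularPoint v 0`.  Proof =
  degenerate slice (nsreg-p7 p510531) ∨ locally constant slope (this file) ∨ LRC″ ⇒ germ ⇒ ns-poloidal-K2-p3 p509715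
  (translations, one slice) / nsreg-p7 p513035 (rotations about any vertical axis, one slice).
* `nonflatLiouville_of_lrc_clebschSlope` — the same with the non-constancy clause spelled in the Clebsch slope `Λ`.
* `nonflatLiouville_of_lrc_slope_spacetime` — the same with the g3 space–time conclusion (`W′ ⊆ W`), for drop-in use.

LOCATED GAP (not needed by the theorems here, recorded for the lead): if LRC″ is registered with SPATIAL pins `∇Λ ≠ 0` only,
the complement inside the non-degenerate set is «slope spatially constant on an open space–time set», which by joint
analyticity makes EVERY slice `s < 0` proportional-shear with its own slope `μ(s)`; `μ(s) > 0` on one slice is kinematic, but a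
NON-CONSTANT `s ↦ μ(s) ≤ 0` («time-dependent proportional shear») is not covered by p511024, whose separated pressure fails:
there `∂₂p = (h′(s,x₂) − μ′(s) v₂)/(1 − μ(s))`.  With the space–time non-constancy clause used below no such gap arises.

WHAT THIS IS NOT: not a claim about Navier–Stokes regularity and not LRC″ — the routine dichotomy and the composition of a
proposed line, sorry-free (bears_on LADDER-NS N0 via crux K2 = stmt-19708).
-/

noncomputable section

-- the summit and its single sub-problem share the name (CONVENTIONS §1), as in every Theorems file
set_option linter.dupNamespace false

namespace Summit.NavierStokesRegularity.NavierStokesRegularity.Theorems.PoloidalWindowDoorPoloidalWindowRigidityK2OfLrcSlope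

open Set Function Filter Topology Metric
open scoped RealInnerProductSpace InnerProductSpace
open Literature.Analysis Literature.Analysis.FluidPDE
open Summit.NavierStokesRegularity.NavierStokesRegularity.Theorems.LocalSineTubeDoorProfileAlignedWindowRigidityAncient
open Summit.NavierStokesRegularity.NavierStokesRegularity.Theorems.TubeAlternative.AnalyticPropagation
open Summit.NavierStokesRegularity.NavierStokesRegularity.Theorems.PoloidalWindowDoorPoloidalWindowRigidityLocalVorticitySymmetry
open Summit.NavierStokesRegularity.NavierStokesRegularity.Theorems.PoloidalWindowDoorPoloidalWindowRigidityDegenerateSlice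
open Summit.NavierStokesRegularity.NavierStokesRegularity.Theorems.PoloidalWindowDoorPoloidalWindowRigidityConstantShear
open Summit.NavierStokesRegularity.NavierStokesRegularity.Theorems.PoloidalWindowDoorPoloidalWindowRigidityProportionalShear
open Summit.NavierStokesRegularity.NavierStokesRegularity.Theorems.PoloidalWindowDoorPoloidalWindowRigidityOneSliceCurlAxisymmetric
open Summit.NavierStokesRegularity.NavierStokesRegularity.Theorems.PoloidalWindowDoorPoloidalWindowRigidityFlat

variable {C : ℝ} {v : ℝ → EuclideanSpace ℝ (Fin 3) → EuclideanSpace ℝ (Fin 3)}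

/-! ### Joint analyticity of the Jacobian entries on the slab -/

/-- The scalar Jacobian entries `(s,y) ↦ D(v s)(y)[e_j]_i` of a profile of the class are jointly real-analytic on the
backward slab. -/
theorem analyticOnNhd_uncurry_fderiv_entry (hrate : HasTypeITimeDecay C v)
    (hcont : ContinuousOn (uncurry v) (Iio (0 : ℝ) ×ˢ univ))
    (hmild : ∀ s t : ℝ, s < t → t < 0 → ∀ x,
      v t x = UnboundedOperators.heatExtension (v s) (t - s) x - oseenDuhamel 1 s v v t x) (j i : Fin 3) :
    AnalyticOnNhd ℝ (uncurry fun s y => fderiv ℝ (v s) y (EuclideanSpace.single j 1) i) (Iio (0 : ℝ) ×ˢ univ) := by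
  have hanV := analyticOnNhd_uncurry hcont (bdd_of_hasTypeITimeDecay hrate) hmild
  have h1 : AnalyticOnNhd ℝ (uncurry fun s y => fderiv ℝ (v s) y (EuclideanSpace.single j 1)) (Iio (0 : ℝ) ×ˢ univ) :=
    analyticOnNhd_uncurry_fderiv_slice_apply hanV isOpen_Iio (v := fun _ _ => EuclideanSpace.single j 1)
      analyticOnNhd_const
  have e : (uncurry fun s y => fderiv ℝ (v s) y (EuclideanSpace.single j 1) i) =
      (EuclideanSpace.proj i : EuclideanSpace ℝ (Fin 3) →L[ℝ] ℝ) ∘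
        (uncurry fun s y => fderiv ℝ (v s) y (EuclideanSpace.single j 1)) := by
    funext z; rfl
  rw [e]
  exact (EuclideanSpace.proj i).comp_analyticOnNhd h1

/-- The scalar Jacobian entries of a profile of the class are continuous on the backward slab. -/
theorem continuousOn_fderiv_entry (hrate : HasTypeITimeDecay C v)
    (hcont : ContinuousOn (uncurry v) (Iio (0 : ℝ) ×ˢ univ))
    (hmild : ∀ s t : ℝ, s < t → t < 0 → ∀ x,
      v t x = UnboundedOperators.heatExtension (v s) (t - s) x - oseenDuhamel 1 s v v t x) (j i : Fin 3) :
    ContinuousOn (fun z : ℝ × EuclideanSpace ℝ (Fin 3) => fderiv ℝ (v z.1) z.2 (EuclideanSpace.single j 1) i)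
      (Iio (0 : ℝ) ×ˢ univ) :=
  (analyticOnNhd_uncurry_fderiv_entry hrate hcont hmild j i).continuousOn

/-! ### Analytic continuation of the constant-shear identity (the dichotomy's first half) -/

/-- **From an open space–time set to the slab.**  If the proportional-shear identities `∂₂v_b = μ ∂_b v₂` (`b = 0, 1`) with a
CONSTANT `μ` hold on a nonempty open subset `W` of the backward slab, they hold at every `s < 0`, `y ∈ ℝ³`. -/
theorem shear_of_local_shear (hrate : HasTypeITimeDecay C v)
    (hcont : ContinuousOn (uncurry v) (Iio (0 : ℝ) ×ˢ univ))
    (hmild : ∀ s t : ℝ, s < t → t < 0 → ∀ x,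
      v t x = UnboundedOperators.heatExtension (v s) (t - s) x - oseenDuhamel 1 s v v t x)
    {μ : ℝ} {W : Set (ℝ × EuclideanSpace ℝ (Fin 3))} (hW : IsOpen W) (hWne : W.Nonempty)
    (hWs : W ⊆ Iio (0 : ℝ) ×ˢ univ)
    (h : ∀ z ∈ W, ∀ b : Fin 3, b ≠ 2 →
      fderiv ℝ (v z.1) z.2 (EuclideanSpace.single 2 1) b = μ * fderiv ℝ (v z.1) z.2 (EuclideanSpace.single b 1) 2) :
    ∀ s < 0, ∀ y, ∀ b : Fin 3, b ≠ 2 →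
      fderiv ℝ (v s) y (EuclideanSpace.single 2 1) b = μ * fderiv ℝ (v s) y (EuclideanSpace.single b 1) 2 := by
  intro s hs y b hb
  -- `F(s,y) = ∂₂v_b − μ ∂_b v₂` is jointly analytic on the slab and vanishes on `W`
  have hanF : AnalyticOnNhd ℝ (uncurry fun s y =>
      fderiv ℝ (v s) y (EuclideanSpace.single 2 1) b - μ * fderiv ℝ (v s) y (EuclideanSpace.single b 1) 2)
      (Iio (0 : ℝ) ×ˢ univ) := by
    have e : (uncurry fun s y =>
        fderiv ℝ (v s) y (EuclideanSpace.single 2 1) b - μ * fderiv ℝ (v s) y (EuclideanSpace.single b 1) 2) =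
        (uncurry fun s y => fderiv ℝ (v s) y (EuclideanSpace.single 2 1) b) -
          μ • (uncurry fun s y => fderiv ℝ (v s) y (EuclideanSpace.single b 1) 2) := by
      funext z; rfl
    rw [e]
    exact (analyticOnNhd_uncurry_fderiv_entry hrate hcont hmild 2 b).sub
      ((analyticOnNhd_uncurry_fderiv_entry hrate hcont hmild b 2).const_smul)
  obtain ⟨z₀, hz₀⟩ := hWne
  have hev : (uncurry fun s y =>
      fderiv ℝ (v s) y (EuclideanSpace.single 2 1) b - μ * fderiv ℝ (v s) y (EuclideanSpace.single b 1) 2) =ᶠ[𝓝 z₀] 0 := by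
    filter_upwards [hW.mem_nhds hz₀] with z hz
    show fderiv ℝ (v z.1) z.2 (EuclideanSpace.single 2 1) b - μ * fderiv ℝ (v z.1) z.2 (EuclideanSpace.single b 1) 2 = 0
    rw [h z hz b hb, sub_self]
  have hpre : IsPreconnected (Iio (0 : ℝ) ×ˢ (univ : Set (EuclideanSpace ℝ (Fin 3)))) :=
    ((convex_Iio 0).prod convex_univ).isPreconnected
  have hzero := hanF.eqOn_zero_of_preconnected_of_eventuallyEq_zero hpre (hWs hz₀) hev
  have := hzero (mk_mem_prod hs (mem_univ y))
  exact sub_eq_zero.1 this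

/-! ### The μ-range: every constant slope is settled -/

/-- **THE WHOLE CONSTANT-SHEAR STRATUM IS EMPTY — every real `μ`.**  Class + poloidal + `∂₂v_b = μ ∂_b v₂` on every slice
(`b = 0, 1`) ⇒ not backward-singular: `μ < 1` is ns-poloidal-K2-p2's dynamic exclusion (p511024), `1 ≤ μ` (`> 0`) is
ns-poloidal-K2-p1's kinematic one (p463086). -/
theorem nonflatLiouville_of_constantShear_real (hrate : HasTypeITimeDecay C v)
    (hcont : ContinuousOn (uncurry v) (Iio (0 : ℝ) ×ˢ univ))
    (hmild : ∀ s t : ℝ, s < t → t < 0 → ∀ x,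
      v t x = UnboundedOperators.heatExtension (v s) (t - s) x - oseenDuhamel 1 s v v t x)
    (hdiv : ∀ t < 0, VectorCalculus.IsDivFree (v t))
    (hpol : ∀ s < 0, ∀ y, ⟪curl (v s) y, EuclideanSpace.single 2 1⟫_ℝ = 0) (μ : ℝ)
    (hslope : ∀ s < 0, ∀ y, ∀ b : Fin 3, b ≠ 2 →
      fderiv ℝ (v s) y (EuclideanSpace.single 2 1) b = μ * fderiv ℝ (v s) y (EuclideanSpace.single b 1) 2) :
    ¬ IsBackwardSingularPoint v 0 := by
  rcases lt_or_ge μ 1 with hμ | hμ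
  · exact nonflatLiouville_of_constantShear hrate hcont hmild hdiv hpol hμ hslope
  · exact nonflatLiouville_of_proportionalShear hrate hcont hmild hdiv hpol (zero_lt_one.trans_le hμ)
      fun s hs y => ⟨hslope s hs y 0 (by decide), hslope s hs y 1 (by decide)⟩

/-- **`stub_constSlope` — LOCALLY CONSTANT SLOPE KILLS THE PROFILE.**  Class + poloidal + the constant-shear identities with
some real `μ` on SOME nonempty open space–time subset of the backward slab ⇒ not backward-singular. -/
theorem nonflatLiouville_of_local_constantShear (hrate : HasTypeITimeDecay C v)
    (hcont : ContinuousOn (uncurry v) (Iio (0 : ℝ) ×ˢ univ))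
    (hmild : ∀ s t : ℝ, s < t → t < 0 → ∀ x,
      v t x = UnboundedOperators.heatExtension (v s) (t - s) x - oseenDuhamel 1 s v v t x)
    (hdiv : ∀ t < 0, VectorCalculus.IsDivFree (v t))
    (hpol : ∀ s < 0, ∀ y, ⟪curl (v s) y, EuclideanSpace.single 2 1⟫_ℝ = 0)
    {μ : ℝ} {W : Set (ℝ × EuclideanSpace ℝ (Fin 3))} (hW : IsOpen W) (hWne : W.Nonempty)
    (hWs : W ⊆ Iio (0 : ℝ) ×ˢ univ)
    (h : ∀ z ∈ W, ∀ b : Fin 3, b ≠ 2 →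
      fderiv ℝ (v z.1) z.2 (EuclideanSpace.single 2 1) b = μ * fderiv ℝ (v z.1) z.2 (EuclideanSpace.single b 1) 2) :
    ¬ IsBackwardSingularPoint v 0 :=
  nonflatLiouville_of_constantShear_real hrate hcont hmild hdiv hpol μ (shear_of_local_shear hrate hcont hmild hW hWne hWs h)

/-! ### The pointwise dictionary Clebsch slope `Λ` ↔ shear slope `μ = 1 − 1/Λ` -/

/-- The horizontal vorticity components in coordinates: `ω₀ = ∂₁v₂ − ∂₂v₁`. -/
theorem curl_apply_zero_eq (V : EuclideanSpace ℝ (Fin 3) → EuclideanSpace ℝ (Fin 3)) (x : EuclideanSpace ℝ (Fin 3)) :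
    curl V x 0 = fderiv ℝ V x (EuclideanSpace.single 1 (1 : ℝ)) 2 - fderiv ℝ V x (EuclideanSpace.single 2 (1 : ℝ)) 1 := by
  simp [curl]

/-- The horizontal vorticity components in coordinates: `ω₁ = ∂₂v₀ − ∂₀v₂`. -/
theorem curl_apply_one_eq (V : EuclideanSpace ℝ (Fin 3) → EuclideanSpace ℝ (Fin 3)) (x : EuclideanSpace ℝ (Fin 3)) :
    curl V x 1 = fderiv ℝ V x (EuclideanSpace.single 2 (1 : ℝ)) 0 - fderiv ℝ V x (EuclideanSpace.single 0 (1 : ℝ)) 2 := by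
  simp [curl]

/-- **Clebsch slope ⇒ shear slope, pointwise.**  If at a point `∂₀v₂ = −Λ ω₁`, `∂₁v₂ = Λ ω₀` and `∇_h v₂ ≠ 0`, then `Λ ≠ 0` and
`∂₂v_b = (1 − 1/Λ) ∂_b v₂` for `b = 0, 1`. -/
theorem shear_of_clebschSlope_of_nondegenerate {V : EuclideanSpace ℝ (Fin 3) → EuclideanSpace ℝ (Fin 3)}
    {x : EuclideanSpace ℝ (Fin 3)} {lam : ℝ}
    (h0 : fderiv ℝ V x (EuclideanSpace.single 0 (1 : ℝ)) 2 = -(lam * curl V x 1))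
    (h1 : fderiv ℝ V x (EuclideanSpace.single 1 (1 : ℝ)) 2 = lam * curl V x 0)
    (hnd : fderiv ℝ V x (EuclideanSpace.single 0 (1 : ℝ)) 2 ≠ 0 ∨ fderiv ℝ V x (EuclideanSpace.single 1 (1 : ℝ)) 2 ≠ 0) :
    lam ≠ 0 ∧ ∀ b : Fin 3, b ≠ 2 →
      fderiv ℝ V x (EuclideanSpace.single 2 1) b = (1 - 1 / lam) * fderiv ℝ V x (EuclideanSpace.single b 1) 2 := by
  rw [curl_apply_one_eq] at h0
  rw [curl_apply_zero_eq] at h1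
  have hlam : lam ≠ 0 := by
    rintro rfl
    simp only [zero_mul, neg_zero] at h0 h1
    exact hnd.elim (fun h => h h0) (fun h => h h1)
  refine ⟨hlam, fun b hb => ?_⟩
  have hb' : b = 0 ∨ b = 1 := by
    rcases b with ⟨_ | _ | _ | n, hn⟩
    · exact Or.inl rfl
    · exact Or.inr rfl
    · exact absurd rfl hb
    · omega
  rcases hb' with rfl | rfl
  · field_simp
    linear_combination h0
  · field_simp
    linear_combination h1

/-! ### The composition `K2 ⇐ LRC″` -/

/-- **`K2 ⇐ LRC″` (class form; conclusion = a symmetry GERM on one slice).**  Let `v` be a profile of the route's Type-I class,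
poloidal along `e₃` on every slice.  Suppose: for every nonempty open `W` in the backward slab on which pointwise
`curl v ≠ 0`, `∇_h v₂ ≠ 0`, `∂₂v_h ≠ 0`, and on which the shear slope is NOWHERE LOCALLY CONSTANT (for no real `μ` and no
nonempty open `W₁ ⊆ W` do the identities `∂₂v_b = μ∂_b v₂`, `b = 0,1`, hold throughout `W₁`), there are a slice `s < 0` and a
nonempty open `U ⊆ ℝ³` on which the vorticity has a translation germ (`D(curl v(s))(y)[e] = 0`, fixed `e ≠ 0`) or a rotation
germ about some vertical axis (`J curl v(s)(y) = D(curl v(s))(y)[J(y − c)]`, fixed `c`).  Then `v` is not backward-singular at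
the apex. -/
theorem nonflatLiouville_of_lrc_slope (hrate : HasTypeITimeDecay C v)
    (hcont : ContinuousOn (uncurry v) (Iio (0 : ℝ) ×ˢ univ))
    (hmild : ∀ s t : ℝ, s < t → t < 0 → ∀ x,
      v t x = UnboundedOperators.heatExtension (v s) (t - s) x - oseenDuhamel 1 s v v t x)
    (hdiv : ∀ t < 0, VectorCalculus.IsDivFree (v t))
    (hpol : ∀ s < 0, ∀ y, ⟪curl (v s) y, EuclideanSpace.single 2 1⟫_ℝ = 0)
    (hLRC : ∀ W : Set (ℝ × EuclideanSpace ℝ (Fin 3)), IsOpen W → W.Nonempty → W ⊆ Iio (0 : ℝ) ×ˢ univ →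
      (∀ z ∈ W, curl (v z.1) z.2 ≠ 0 ∧
        (fderiv ℝ (v z.1) z.2 (EuclideanSpace.single 0 1) 2 ≠ 0 ∨ fderiv ℝ (v z.1) z.2 (EuclideanSpace.single 1 1) 2 ≠ 0) ∧
        (fderiv ℝ (v z.1) z.2 (EuclideanSpace.single 2 1) 0 ≠ 0 ∨ fderiv ℝ (v z.1) z.2 (EuclideanSpace.single 2 1) 1 ≠ 0)) →
      (∀ μ : ℝ, ∀ W₁ : Set (ℝ × EuclideanSpace ℝ (Fin 3)), W₁ ⊆ W → IsOpen W₁ → W₁.Nonempty →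
        ∃ z ∈ W₁, ∃ b : Fin 3, b ≠ 2 ∧
          fderiv ℝ (v z.1) z.2 (EuclideanSpace.single 2 1) b ≠ μ * fderiv ℝ (v z.1) z.2 (EuclideanSpace.single b 1) 2) →
      ∃ s : ℝ, s < 0 ∧ ∃ U : Set (EuclideanSpace ℝ (Fin 3)), IsOpen U ∧ U.Nonempty ∧
        ((∃ e : EuclideanSpace ℝ (Fin 3), e ≠ 0 ∧ ∀ y ∈ U, fderiv ℝ (curl (v s)) y e = 0) ∨
         (∃ c : EuclideanSpace ℝ (Fin 3), ∀ y ∈ U,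
            rotGen (curl (v s) y) = fderiv ℝ (curl (v s)) y (rotGen (y - c))))) :
    ¬ IsBackwardSingularPoint v 0 := by
  -- the slab and the joint continuity of `curl v` and of the Jacobian entries on it
  set O : Set (ℝ × EuclideanSpace ℝ (Fin 3)) := Iio (0 : ℝ) ×ˢ univ with hO
  have hOo : IsOpen O := isOpen_Iio.prod isOpen_univ
  have hanV := analyticOnNhd_uncurry hcont (bdd_of_hasTypeITimeDecay hrate) hmild
  have hcurlc : ContinuousOn (uncurry fun s y => curl (v s) y) O := (analyticOnNhd_uncurry_curl hanV isOpen_Iio).continuousOn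
  have hent : ∀ (j i : Fin 3), ContinuousOn
      (fun z : ℝ × EuclideanSpace ℝ (Fin 3) => fderiv ℝ (v z.1) z.2 (EuclideanSpace.single j 1) i) O :=
    fun j i => continuousOn_fderiv_entry hrate hcont hmild j i
  -- the non-degeneracy predicate
  set ND : ℝ × EuclideanSpace ℝ (Fin 3) → Prop := fun z => curl (v z.1) z.2 ≠ 0 ∧
      (fderiv ℝ (v z.1) z.2 (EuclideanSpace.single 0 1) 2 ≠ 0 ∨ fderiv ℝ (v z.1) z.2 (EuclideanSpace.single 1 1) 2 ≠ 0) ∧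
      (fderiv ℝ (v z.1) z.2 (EuclideanSpace.single 2 1) 0 ≠ 0 ∨ fderiv ℝ (v z.1) z.2 (EuclideanSpace.single 2 1) 1 ≠ 0)
    with hND
  by_cases hdeg : ∀ y : EuclideanSpace ℝ (Fin 3), ¬ ND (-1, y)
  · -- every point of the slice `s = −1` is degenerate: nsreg-p7's trichotomy
    refine nonflatLiouville_of_pointwise_degenerate_slice hrate hcont hmild hdiv (by norm_num : (-1 : ℝ) < 0)
      (hpol (-1) (by norm_num)) fun y => ?_
    have h := hdeg y
    simp only [hND, not_and_or, not_or, not_not] at h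
    rcases h with h | h | h
    · exact Or.inl h
    · exact Or.inr (Or.inl ⟨h.1, h.2⟩)
    · exact Or.inr (Or.inr ⟨h.1, h.2⟩)
  · -- the non-degenerate part `N` of the slab is a nonempty open space–time set
    push Not at hdeg
    obtain ⟨y₀, hy₀⟩ := hdeg
    set N : Set (ℝ × EuclideanSpace ℝ (Fin 3)) := {z | z ∈ O ∧ ND z} with hN
    have hNO : N ⊆ O := fun z hz => hz.1
    have hNne : N.Nonempty := ⟨(-1, y₀), ⟨mk_mem_prod (by norm_num : (-1 : ℝ) ∈ Iio 0) (mem_univ _), hy₀⟩⟩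
    have hNopen : IsOpen N := by
      rw [isOpen_iff_mem_nhds]
      rintro z ⟨hzO, hA, hB, hCc⟩
      have hOz : O ∈ 𝓝 z := hOo.mem_nhds hzO
      have eA : ∀ᶠ w in 𝓝 z, curl (v w.1) w.2 ≠ 0 :=
        ((hcurlc z hzO).continuousAt hOz).eventually_ne hA
      have eB : ∀ᶠ w in 𝓝 z, fderiv ℝ (v w.1) w.2 (EuclideanSpace.single 0 1) 2 ≠ 0 ∨
          fderiv ℝ (v w.1) w.2 (EuclideanSpace.single 1 1) 2 ≠ 0 := by
        rcases hB with hB | hB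
        · exact (((hent 0 2) z hzO).continuousAt hOz |>.eventually_ne hB).mono fun w hw => Or.inl hw
        · exact (((hent 1 2) z hzO).continuousAt hOz |>.eventually_ne hB).mono fun w hw => Or.inr hw
      have eC : ∀ᶠ w in 𝓝 z, fderiv ℝ (v w.1) w.2 (EuclideanSpace.single 2 1) 0 ≠ 0 ∨
          fderiv ℝ (v w.1) w.2 (EuclideanSpace.single 2 1) 1 ≠ 0 := by
        rcases hCc with hCc | hCc
        · exact (((hent 2 0) z hzO).continuousAt hOz |>.eventually_ne hCc).mono fun w hw => Or.inl hw
        · exact (((hent 2 1) z hzO).continuousAt hOz |>.eventually_ne hCc).mono fun w hw => Or.inr hw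
      have eO : ∀ᶠ w in 𝓝 z, w ∈ O := hOz
      filter_upwards [eO, eA, eB, eC] with w hwO hwA hwB hwC
      exact ⟨hwO, hwA, hwB, hwC⟩
    -- dichotomy: locally constant slope somewhere in `N`, or nowhere
    by_cases hloc : ∃ μ : ℝ, ∃ W₁ : Set (ℝ × EuclideanSpace ℝ (Fin 3)), W₁ ⊆ N ∧ IsOpen W₁ ∧ W₁.Nonempty ∧
        ∀ z ∈ W₁, ∀ b : Fin 3, b ≠ 2 →
          fderiv ℝ (v z.1) z.2 (EuclideanSpace.single 2 1) b = μ * fderiv ℝ (v z.1) z.2 (EuclideanSpace.single b 1) 2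
    · obtain ⟨μ, W₁, hW₁N, hW₁o, hW₁ne, hW₁⟩ := hloc
      exact nonflatLiouville_of_local_constantShear hrate hcont hmild hdiv hpol hW₁o hW₁ne (hW₁N.trans hNO) hW₁
    · push Not at hloc
      have hnc : ∀ μ : ℝ, ∀ W₁ : Set (ℝ × EuclideanSpace ℝ (Fin 3)), W₁ ⊆ N → IsOpen W₁ → W₁.Nonempty →
          ∃ z ∈ W₁, ∃ b : Fin 3, b ≠ 2 ∧
            fderiv ℝ (v z.1) z.2 (EuclideanSpace.single 2 1) b ≠ μ * fderiv ℝ (v z.1) z.2 (EuclideanSpace.single b 1) 2 := by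
        intro μ W₁ h1 h2 h3
        obtain ⟨z, hz, b, hb, hne⟩ := hloc μ W₁ h1 h2 h3
        exact ⟨z, hz, b, hb, hne⟩
      obtain ⟨s, hs, U, hUo, hUne, hsym⟩ := hLRC N hNopen hNne hNO (fun z hz => hz.2) hnc
      rcases hsym with ⟨e, he, htr⟩ | ⟨c, hrot⟩
      · exact nonflatLiouville_of_local_curl_translation hrate hcont hmild hdiv hs he hUo hUne htr
      · exact nonflatLiouville_of_curl_rotDefect_eq_zero_on_open hrate hcont hmild hdiv hpol c hs hUo hUne hrot

/-- **`K2 ⇐ LRC″`, Clebsch spelling of the non-constancy clause.**  As `nonflatLiouville_of_lrc_slope`, but the hypothesis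
asks for the symmetry germ on non-degenerate open space–time sets on which the CLEBSCH SLOPE is nowhere locally constant: for
no real `Λ` and no nonempty open `W₁ ⊆ W` do `∂₀v₂ = −Λ ω₁`, `∂₁v₂ = Λ ω₀` hold throughout `W₁`. -/
theorem nonflatLiouville_of_lrc_clebschSlope (hrate : HasTypeITimeDecay C v)
    (hcont : ContinuousOn (uncurry v) (Iio (0 : ℝ) ×ˢ univ))
    (hmild : ∀ s t : ℝ, s < t → t < 0 → ∀ x,
      v t x = UnboundedOperators.heatExtension (v s) (t - s) x - oseenDuhamel 1 s v v t x)
    (hdiv : ∀ t < 0, VectorCalculus.IsDivFree (v t))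
    (hpol : ∀ s < 0, ∀ y, ⟪curl (v s) y, EuclideanSpace.single 2 1⟫_ℝ = 0)
    (hLRC : ∀ W : Set (ℝ × EuclideanSpace ℝ (Fin 3)), IsOpen W → W.Nonempty → W ⊆ Iio (0 : ℝ) ×ˢ univ →
      (∀ z ∈ W, curl (v z.1) z.2 ≠ 0 ∧
        (fderiv ℝ (v z.1) z.2 (EuclideanSpace.single 0 1) 2 ≠ 0 ∨ fderiv ℝ (v z.1) z.2 (EuclideanSpace.single 1 1) 2 ≠ 0) ∧
        (fderiv ℝ (v z.1) z.2 (EuclideanSpace.single 2 1) 0 ≠ 0 ∨ fderiv ℝ (v z.1) z.2 (EuclideanSpace.single 2 1) 1 ≠ 0)) →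
      (∀ lam : ℝ, ∀ W₁ : Set (ℝ × EuclideanSpace ℝ (Fin 3)), W₁ ⊆ W → IsOpen W₁ → W₁.Nonempty →
        ∃ z ∈ W₁, fderiv ℝ (v z.1) z.2 (EuclideanSpace.single 0 (1 : ℝ)) 2 ≠ -(lam * curl (v z.1) z.2 1) ∨
          fderiv ℝ (v z.1) z.2 (EuclideanSpace.single 1 (1 : ℝ)) 2 ≠ lam * curl (v z.1) z.2 0) →
      ∃ s : ℝ, s < 0 ∧ ∃ U : Set (EuclideanSpace ℝ (Fin 3)), IsOpen U ∧ U.Nonempty ∧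
        ((∃ e : EuclideanSpace ℝ (Fin 3), e ≠ 0 ∧ ∀ y ∈ U, fderiv ℝ (curl (v s)) y e = 0) ∨
         (∃ c : EuclideanSpace ℝ (Fin 3), ∀ y ∈ U,
            rotGen (curl (v s) y) = fderiv ℝ (curl (v s)) y (rotGen (y - c))))) :
    ¬ IsBackwardSingularPoint v 0 := by
  refine nonflatLiouville_of_lrc_slope hrate hcont hmild hdiv hpol fun W hW hWne hWs hnd hnc => hLRC W hW hWne hWs hnd ?_
  -- Clebsch-constancy on `W₁` would give shear-constancy on `W₁` with `μ = 1 − 1/Λ`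
  intro lam W₁ hW₁W hW₁o hW₁ne
  by_contra hcon
  push Not at hcon
  obtain ⟨z, hz, b, hb, hne⟩ := hnc (1 - 1 / lam) W₁ hW₁W hW₁o hW₁ne
  obtain ⟨h0, h1⟩ := hcon z hz
  exact hne ((shear_of_clebschSlope_of_nondegenerate h0 h1 (hnd z (hW₁W hz)).2.1).2 b hb)

/-- **`K2 ⇐ LRC″`, space–time conclusion (drop-in for the g3 skeleton draft).**  As `nonflatLiouville_of_lrc_slope`, but with
the conclusion of LRC″ in the form of `…K2OfLrc.nonflatLiouville_of_lrc`: a nonempty open space–time `W′ ⊆ W` carrying a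
translation generator `e ≠ 0` or a rotation generator about the vertical axis through `c`. -/
theorem nonflatLiouville_of_lrc_slope_spacetime (hrate : HasTypeITimeDecay C v)
    (hcont : ContinuousOn (uncurry v) (Iio (0 : ℝ) ×ˢ univ))
    (hmild : ∀ s t : ℝ, s < t → t < 0 → ∀ x,
      v t x = UnboundedOperators.heatExtension (v s) (t - s) x - oseenDuhamel 1 s v v t x)
    (hdiv : ∀ t < 0, VectorCalculus.IsDivFree (v t))
    (hpol : ∀ s < 0, ∀ y, ⟪curl (v s) y, EuclideanSpace.single 2 1⟫_ℝ = 0)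
    (hLRC : ∀ W : Set (ℝ × EuclideanSpace ℝ (Fin 3)), IsOpen W → W.Nonempty → W ⊆ Iio (0 : ℝ) ×ˢ univ →
      (∀ z ∈ W, curl (v z.1) z.2 ≠ 0 ∧
        (fderiv ℝ (v z.1) z.2 (EuclideanSpace.single 0 1) 2 ≠ 0 ∨ fderiv ℝ (v z.1) z.2 (EuclideanSpace.single 1 1) 2 ≠ 0) ∧
        (fderiv ℝ (v z.1) z.2 (EuclideanSpace.single 2 1) 0 ≠ 0 ∨ fderiv ℝ (v z.1) z.2 (EuclideanSpace.single 2 1) 1 ≠ 0)) →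
      (∀ μ : ℝ, ∀ W₁ : Set (ℝ × EuclideanSpace ℝ (Fin 3)), W₁ ⊆ W → IsOpen W₁ → W₁.Nonempty →
        ∃ z ∈ W₁, ∃ b : Fin 3, b ≠ 2 ∧
          fderiv ℝ (v z.1) z.2 (EuclideanSpace.single 2 1) b ≠ μ * fderiv ℝ (v z.1) z.2 (EuclideanSpace.single b 1) 2) →
      ∃ W' : Set (ℝ × EuclideanSpace ℝ (Fin 3)), W' ⊆ W ∧ IsOpen W' ∧ W'.Nonempty ∧
        ((∃ e : EuclideanSpace ℝ (Fin 3), e ≠ 0 ∧ ∀ z ∈ W', fderiv ℝ (curl (v z.1)) z.2 e = 0) ∨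
         (∃ c : EuclideanSpace ℝ (Fin 3), ∀ z ∈ W',
            fderiv ℝ (curl (v z.1)) z.2 (rotGen (z.2 - c)) = rotGen (curl (v z.1) z.2)))) :
    ¬ IsBackwardSingularPoint v 0 := by
  refine nonflatLiouville_of_lrc_slope hrate hcont hmild hdiv hpol fun W hW hWne hWs hnd hnc => ?_
  obtain ⟨W', hW'W, hW'o, hW'ne, hsym⟩ := hLRC W hW hWne hWs hnd hnc
  -- slice the space–time open set `W′` at one of its points
  obtain ⟨z₁, hz₁⟩ := hW'ne
  have hs : z₁.1 < 0 := (mem_prod.1 (hWs (hW'W hz₁))).1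
  set U : Set (EuclideanSpace ℝ (Fin 3)) := {y | (z₁.1, y) ∈ W'} with hU
  have hUopen : IsOpen U := hW'o.preimage (Continuous.prodMk_right z₁.1)
  have hUne : U.Nonempty := ⟨z₁.2, by simpa [hU] using hz₁⟩
  refine ⟨z₁.1, hs, U, hUopen, hUne, ?_⟩
  rcases hsym with ⟨e, he, htr⟩ | ⟨c, hrot⟩
  · exact Or.inl ⟨e, he, fun y hy => htr (z₁.1, y) hy⟩
  · exact Or.inr ⟨c, fun y hy => (hrot (z₁.1, y) hy).symm⟩

end Summit.NavierStokesRegularity.NavierStokesRegularity.Theorems.PoloidalWindowDoorPoloidalWindowRigidityK2OfLrcSlope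

end
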